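import Literature.Computability.MetaComplexity.BoundedArithS2Graphs
import HarnessLib

/-!
# Bounded iteration with history and digit-wise comprehension as `Σᵇ₁` definitions of `S₂¹`

Topic `Literature/Computability/MetaComplexity`.  The two sequence constructions by which `S₂¹`
`Σᵇ₁`-defines new functions from old ones (Buss 1986, §2.5–2.6: `Σᵇ₁`-definable functions of
`S₂¹` are closed under *limited iteration* / bounded recursion along a length; Krajíček 1995,
Lemma 5.2.12 (`S₂ⁱ ⊢ BBΣᵇᵢ`, sharply bounded collection) and Lemma 6.1.1 (the computation of a
polynomial-time machine is `Σᵇ₁`-defined by limited recursion)), as *good uniform definitions*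
(`GDef.Good`, `BoundedArithS2Graphs.lean`), i.e. total and functional in every model of
`BASIC + Σᵇ₁-PIND`:

* `GDef.eqG E F` — the `Σᵇ₁` formula "`E(x̄) = F(x̄)`" for two good definitions;
* **`GDef.collect D ℓ β`** — from a good `D(x̄, i)` ("the `i`-th digit") and terms `ℓ(x̄)`,
  `β(x̄)`, the code `w < 2^{|ℓ|·B}` whose `B`-bit blocks are `blk(w, i) = D(x̄, i) mod 2ᴮ` for all
  `i < |ℓ(x̄)|`, `B = |β(x̄)|` (sharply bounded collection / comprehension; the truncation is the
  identity whenever the digits are `< 2ᴮ`, `GDef.blk_collect_of_lt`);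
* **`GDef.hist I G ℓ β`** — from good `I(x̄)`, `G(x̄, j, u)` and terms `ℓ, β`, the *history* of the
  bounded iteration `u₀ = I(x̄) mod 2ᴮ`, `u_{j+1} = G(x̄, j, u_j) mod 2ᴮ` (`j < |ℓ(x̄)|`, `B = |β(x̄)|`):
  the code `w < 2^{(|ℓ|+1)·B}` with `blk(w, j) = u_j` (`GDef.good_hist`, `GDef.blk_hist_zero`,
  `GDef.blk_hist_succ`); and `GDef.iterate I G ℓ β` — the final value `u_{|ℓ|}`.

Existence is proved in each model by `Σᵇ₁`-induction along `[0, |ℓ|]` appending one block on top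
at each step (`BoundedArithS2Blocks.lean`; no digit is ever overwritten, so no subtraction is
needed), uniqueness by extensionality of block codes.  The induction formulas are instances (one
more free variable for the prefix length) of the defining `SForm`s themselves, so their `Σᵇ₁`
certificates are structural.

## References

* S. R. Buss, *Bounded Arithmetic*, Bibliopolis 1986, §§2.5–2.6 (sequence coding, limited
  iteration; Thm. 2.2–2.3 area).
* J. Krajíček, *Bounded Arithmetic, Propositional Logic and Complexity Theory*, CUP 1995,
  Lemma 5.2.12 (p. 69), Lemma 6.1.1 (p. 86).
-/

namespace Literature.Computability.MetaComplexity

open FirstOrder FirstOrder.Language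

namespace GDef

variable {n : ℕ}

/-! ## Equations between good definitions -/

/-- The `Σᵇ₁` formula **`E(x̄) = F(x̄)`** for two definitions: `∃ y ≤ t_E(x̄) (φ_E(x̄, y) ∧ φ_F(x̄, y))`
(Buss 1986, §2.2, Thm. 2.2: atomic formulas between `Σᵇ₁`-defined functions are `Δᵇ₁`).
[cite: Buss1986, §2.2, Thm. 2.2] -/
def eqG (E F : GDef n) : SForm n := SForm.bex E.bound (SForm.and E.graph F.graph)

section EqG

open BASICModel

variable {M : Type} [Language.boundedArith.Structure M] [hB : M ⊨ BASIC]
  [hP : M ⊨ PINDScheme (sigmabFormulas 1)]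
variable {E F : GDef n}

omit [Language.boundedArith.Structure M] hB hP in
/-- `eqG` of `Σᵇ₁` definitions is `Σᵇ₁`. [folklore] -/
theorem isSig_eqG (hE : E.graph.IsSig) (hF : F.graph.IsSig) : (eqG E F).IsSig := by
  simp_all [SForm.IsSig, eqG, SForm.cls]

/-- **Semantics of `eqG`**: for good definitions, `E(x̄) = F(x̄)`. [cite: Buss1986, §2.2, Thm. 2.2] -/
theorem realize_eqG (hE : E.Good) (hF : F.Good) (v : Fin n → M) :
    (eqG E F).Realize v ↔ E.fn v = F.fn v := by
  simp only [eqG, SForm.realize_bex, SForm.realize_and]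
  constructor
  · rintro ⟨y, -, hy, hy'⟩
    rw [hE.isFnIn.fn_eq_of_rel hy, hF.isFnIn.fn_eq_of_rel hy']
  · intro h
    exact ⟨E.fn v, hE.isFnIn.fn_le v, hE.isFnIn.rel_fn v, h ▸ hF.isFnIn.rel_fn v⟩

end EqG

/-! ## Index and term bookkeeping -/

section Plumbing

variable {M : Type}

/-- `Fin.castAdd 1 = Fin.castSucc`. [folklore] -/
theorem castAdd_one_eq (i : Fin n) : (Fin.castAdd 1 i : Fin (n + 1)) = i.castSucc := rfl

/-- `Fin.castAdd 2 i = i.castSucc.castSucc`. [folklore] -/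
theorem castAdd_two_eq (i : Fin n) : (Fin.castAdd 2 i : Fin (n + 2)) = i.castSucc.castSucc :=
  Fin.ext rfl

/-- `Fin.castAdd 3 i = i.castSucc.castSucc.castSucc`. [folklore] -/
theorem castAdd_three_eq (i : Fin n) :
    (Fin.castAdd 3 i : Fin (n + 3)) = i.castSucc.castSucc.castSucc := Fin.ext rfl

/-- `Fin.castAdd 4 i = i.castSucc⁴`. [folklore] -/
theorem castAdd_four_eq (i : Fin n) :
    (Fin.castAdd 4 i : Fin (n + 4)) = i.castSucc.castSucc.castSucc.castSucc := Fin.ext rfl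

/-- `(x̄, a) ∘ castAdd 1 = x̄`. [folklore] -/
@[simp] theorem snoc_comp_castAdd_one (x : Fin n → M) (a : M) :
    (Fin.snoc x a : Fin (n + 1) → M) ∘ Fin.castAdd 1 = x := by
  funext i; simp [castAdd_one_eq]

/-- `(x̄, a, b) ∘ castAdd 2 = x̄`. [folklore] -/
@[simp] theorem snoc₂_comp_castAdd_two (x : Fin n → M) (a b : M) :
    (Fin.snoc (Fin.snoc x a) b : Fin (n + 2) → M) ∘ Fin.castAdd 2 = x := by
  funext i; simp [castAdd_two_eq]

/-- `(x̄, a, b, c) ∘ castAdd 3 = x̄`. [folklore] -/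
@[simp] theorem snoc₃_comp_castAdd_three (x : Fin n → M) (a b c : M) :
    (Fin.snoc (Fin.snoc (Fin.snoc x a) b) c : Fin (n + 3) → M) ∘ Fin.castAdd 3 = x := by
  funext i; simp [castAdd_three_eq]

/-- `(x̄, a, b, c, d) ∘ castAdd 4 = x̄`. [folklore] -/
@[simp] theorem snoc₄_comp_castAdd_four (x : Fin n → M) (a b c d : M) :
    (Fin.snoc (Fin.snoc (Fin.snoc (Fin.snoc x a) b) c) d : Fin (n + 4) → M) ∘ Fin.castAdd 4 = x := by
  funext i; simp [castAdd_four_eq]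

/-- The variable `m` (index `n`) of the context `(x̄, m, w)`. [folklore] -/
abbrev vM2 (n : ℕ) : Language.boundedArith.Term (Fin (n + 2)) := Term.var (Fin.last n).castSucc
/-- The variable `w` (index `n + 1`) of the context `(x̄, m, w)`. [folklore] -/
abbrev vW2 (n : ℕ) : Language.boundedArith.Term (Fin (n + 2)) := Term.var (Fin.last (n + 1))
/-- The variable `m` of the context `(x̄, m, w, j)`. [folklore] -/
abbrev vM3 (n : ℕ) : Language.boundedArith.Term (Fin (n + 3)) :=
  Term.var (Fin.last n).castSucc.castSucc
/-- The variable `w` of the context `(x̄, m, w, j)`. [folklore] -/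
abbrev vW3 (n : ℕ) : Language.boundedArith.Term (Fin (n + 3)) :=
  Term.var (Fin.last (n + 1)).castSucc
/-- The variable `j` of the context `(x̄, m, w, j)`. [folklore] -/
abbrev vJ3 (n : ℕ) : Language.boundedArith.Term (Fin (n + 3)) := Term.var (Fin.last (n + 2))
/-- The variable `w` of the context `(x̄, m, w, j, u)`. [folklore] -/
abbrev vW4 (n : ℕ) : Language.boundedArith.Term (Fin (n + 4)) :=
  Term.var (Fin.last (n + 1)).castSucc.castSucc
/-- The variable `j` of the context `(x̄, m, w, j, u)`. [folklore] -/
abbrev vJ4 (n : ℕ) : Language.boundedArith.Term (Fin (n + 4)) :=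
  Term.var (Fin.last (n + 2)).castSucc
/-- The variable `u` of the context `(x̄, m, w, j, u)`. [folklore] -/
abbrev vU4 (n : ℕ) : Language.boundedArith.Term (Fin (n + 4)) := Term.var (Fin.last (n + 3))

end Plumbing

/-! ## The size parameters of a sequence construction -/

/-- The size parameter `S(x̄) = (2·ℓ(x̄) + 1) # β(x̄)` of a sequence of `|ℓ(x̄)| + 1` blocks of width
`|β(x̄)|`: `|S| = (|ℓ| + 1)·|β| + 1` bounds every bit offset used. [cite: Buss1986, §2.5] -/
def sizeT (ℓ β : Language.boundedArith.Term (Fin n)) : Language.boundedArith.Term (Fin n) :=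
  Term.smash (Term.succ (natConst 2 * ℓ)) β

section Size

open BASICModel

variable {M : Type} [Language.boundedArith.Structure M] [hB : M ⊨ BASIC]
  [hP : M ⊨ PINDScheme (sigmabFormulas 1)]

omit hP in
/-- The value of `sizeT`. [folklore] -/
@[simp] theorem realize_sizeT (ℓ β : Language.boundedArith.Term (Fin n)) (x : Fin n → M) :
    (sizeT ℓ β).realize x = mSmash (2 * ℓ.realize x + 1) (β.realize x) := by
  simp [sizeT, one_add_one_eq_two]

omit hP in
/-- `|S| = (|ℓ| + 1)·|β| + 1`. [cite: Buss1986, §2.5] -/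
theorem mLen_size (l b : M) : mLen (mSmash (2 * l + 1) b) = (mLen l + 1) * mLen b + 1 := by
  rw [mLen_mSmash, mLen_two_mul_add_one]

/-- Offsets of the form `(m + 1)·B` with `m ≤ |ℓ|` are below `|S|`. [folklore] -/
theorem succ_mul_le_mLen_size {l b m : M} (hm : m ≤ mLen l) :
    (m + 1) * mLen b ≤ mLen (mSmash (2 * l + 1) b) := by
  rw [mLen_size]
  exact (mul_le_mul'' (add_le_add_left hm 1) le_rfl).trans (le_add_right'' _ _)

/-- Offsets `m·B + B` with `m ≤ |ℓ|` are below `|S|`. [folklore] -/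
theorem mul_add_le_mLen_size {l b m : M} (hm : m ≤ mLen l) :
    m * mLen b + mLen b ≤ mLen (mSmash (2 * l + 1) b) := by
  have := succ_mul_le_mLen_size (b := b) hm
  rwa [add_mul, one_mul] at this

omit hP in
/-- Offsets `m·B` with `m ≤ |ℓ| + 1` are below `|S|`. [folklore] -/
theorem mul_le_mLen_size {l b m : M} (hm : m ≤ mLen l + 1) :
    m * mLen b ≤ mLen (mSmash (2 * l + 1) b) := by
  rw [mLen_size]
  exact (mul_le_mul'' hm le_rfl).trans (le_add_right'' _ _)

/-- `|ℓ| + 1 ≤ |S|`. [folklore] -/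
theorem mLen_succ_le_mLen_size (l b : M) (hb : 1 ≤ mLen b) :
    mLen l + 1 ≤ mLen (mSmash (2 * l + 1) b) := by
  have := mul_le_mLen_size (l := l) (b := b) (m := mLen l + 1) le_rfl
  exact le_trans (by simpa using mul_le_mul'' (le_refl (mLen l + 1)) hb) this

/-- `|β| ≤ |S|`. [folklore] -/
theorem mLen_le_mLen_size (l b : M) : mLen b ≤ mLen (mSmash (2 * l + 1) b) := by
  have := mul_le_mLen_size (l := l) (b := b) (m := 1) (by simpa using (zero_le_model (mLen l)))
  rwa [one_mul] at this

/-- A value `≤ β` is a block value: `v < 2^{|β|}`. [folklore] -/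
theorem lt_pw_mLen_of_le {S b v : M} (hv : v ≤ b) (hb : mLen b ≤ mLen S) : v < pw S (mLen b) :=
  (lt_pw_iff hb v).2 (mLen_le_mLen hv)


/-- The size parameter `S(x̄) = (2ℓ+1) # β` of a sequence construction, in a structure. [folklore] -/
noncomputable def seqS (ℓ β : Language.boundedArith.Term (Fin n)) (x : Fin n → M) : M :=
  (sizeT ℓ β).realize x

/-- The block width `B(x̄) = |β(x̄)|` of a sequence construction, in a structure. [folklore] -/
noncomputable def seqB (β : Language.boundedArith.Term (Fin n)) (x : Fin n → M) : M :=
  mLen (β.realize x)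

variable {ℓ β : Language.boundedArith.Term (Fin n)}

omit hP in
/-- The value of `seqS`. [folklore] -/
theorem seqS_eq (x : Fin n → M) : seqS ℓ β x = mSmash (2 * ℓ.realize x + 1) (β.realize x) := by
  simp [seqS]

/-- `B ≤ |S|`. [folklore] -/
theorem seqB_le (x : Fin n → M) : seqB β x ≤ mLen (seqS ℓ β x) := by
  rw [seqS_eq]; exact mLen_le_mLen_size _ _

end Size

/-! ## Digit-wise comprehension (`collect`) -/

section Collect

variable (D : GDef (n + 1)) (ℓ β : Language.boundedArith.Term (Fin n))

/-- The digit `lsp(S, D(x̄, i), B)` on the context `(x̄, m, w, i)` (truncation to `B = |β|` bits).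
[folklore] -/
def collectDigit : GDef (n + 3) :=
  let S4 := (sizeT ℓ β).relabel (Fin.castAdd 4)
  let B4 := Term.len (β.relabel (Fin.castAdd 4))
  substLast (substArgs ![S4, vU4 n, B4] lspG)
    (substArgs (Fin.snoc (fun j => Term.var (Fin.castAdd 3 j)) (vJ3 n)) D)

/-- The core formula of `collect` on the context `(x̄, m, w)`: "`w < 2^{m·B}` and
`blk(w, i) = D(x̄, i) mod 2ᴮ` for all `i < m`" (`i` ranging over `[0, |ℓ|]`), with `B = |β|`,
`S = sizeT ℓ β`:
`msp(S, w, m·B) = 0 ∧ ∀ i ≤ |ℓ| (i < m → blk(S, w, i, B) = lsp(S, D(x̄, i), B))`. [cite: Buss1986, §2.5] -/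
def collectCore : SForm (n + 2) :=
  let S2 := (sizeT ℓ β).relabel (Fin.castAdd 2)
  let B2 := Term.len (β.relabel (Fin.castAdd 2))
  let S3 := (sizeT ℓ β).relabel (Fin.castAdd 3)
  let B3 := Term.len (β.relabel (Fin.castAdd 3))
  SForm.and
    (eqG (substArgs ![S2, vW2 n, vM2 n * B2] mspG) (num (n + 2) 0))
    (SForm.ballLen (ℓ.relabel (Fin.castAdd 2))
      (SForm.imp (SForm.lt (vJ3 n) (vM3 n))
        (eqG (substArgs ![S3, vW3 n, vJ3 n, B3] blkG) (collectDigit D ℓ β))))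

/-- **`collect D ℓ β`** — sharply bounded comprehension: the code `w` with `w < 2^{|ℓ|·B}` and
`blk(w, i) = D(x̄, i) mod 2ᴮ` for `i < |ℓ(x̄)|` (`B = |β|`); graph `collectCore` at `m := |ℓ|`,
bound `1 # S` (Buss 1986, §2.5; Krajíček 1995, Lemma 5.2.12: `S₂¹ ⊢ BBΣᵇ₁`).
[cite: Krajicek1995, Lemma 5.2.12 (p. 69)] -/
def collect : GDef n where
  graph := (collectCore D ℓ β).subst
    (Fin.snoc (Fin.snoc (fun j => Term.var j.castSucc) (Term.len (ℓ.relabel Fin.castSucc)))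
      (Term.var (Fin.last n)))
  bound := Term.smash (natConst 1) (sizeT ℓ β)

open BASICModel

variable {D ℓ β}
variable {M : Type} [Language.boundedArith.Structure M] [hB : M ⊨ BASIC]
  [hP : M ⊨ PINDScheme (sigmabFormulas 1)]

omit [Language.boundedArith.Structure M] hB hP in
/-- `collectDigit` is good for good `D`. [folklore] -/
theorem good_collectDigit (hD : D.Good) : (collectDigit D ℓ β).Good :=
  (good_lspG.substArgs _).substLast (hD.substArgs _)

omit [Language.boundedArith.Structure M] hB hP in
/-- `collectCore` is `Σᵇ₁` for good `D`. [folklore] -/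
theorem isSig_collectCore (hD : D.graph.IsSig) : (collectCore D ℓ β).IsSig := by
  have h1 : mspG.graph.cls.2.1 = true := good_mspG.sig
  have h2 : blkG.graph.cls.2.1 = true := good_blkG.sig
  have h3 : lspG.graph.cls.2.1 = true := good_lspG.sig
  simp_all [SForm.IsSig, collectCore, collectDigit, SForm.cls, eqG, GDef.substArgs,
    GDef.substLast, num, ofTerm, SForm.lt]

omit hB hP in
/-- The arguments `(x̄, j)` of `D` read off the context `(x̄, m, w, j)`. [folklore] -/
theorem realize_argsD (x : Fin n → M) (m w i : M) :
    (fun j => Term.realize (Fin.snoc (Fin.snoc (Fin.snoc x m) w) i : Fin (n + 3) → M)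
      (Fin.snoc (α := fun _ => Language.boundedArith.Term (Fin (n + 3)))
        (fun j => Term.var (Fin.castAdd 3 j)) (vJ3 n) j)) = Fin.snoc x i := by
  funext j
  cases j using Fin.lastCases with
  | last => simp
  | cast j => simp [castAdd_three_eq]

/-- The value of `collectDigit`: `lsp(S, D(x̄, i), B)`. [folklore] -/
theorem fn_collectDigit (hD : D.Good) (x : Fin n → M) (m w i : M) :
    (collectDigit D ℓ β).fn (Fin.snoc (Fin.snoc (Fin.snoc x m) w) i) =
      lsp (seqS ℓ β x) (D.fn (Fin.snoc x i)) (seqB β x) := by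
  rw [collectDigit, fn_substLast (good_lspG.substArgs _) (hD.substArgs _), fn_substArgs good_lspG,
    fn_substArgs hD, fn_lspG, realize_argsD]
  simp [Term.realize_relabel, seqS, seqB]

/-- **Semantics of `collectCore`**. [cite: Buss1986, §2.5] -/
theorem realize_collectCore (hD : D.Good) (x : Fin n → M) (m w : M) :
    (collectCore D ℓ β).Realize (Fin.snoc (Fin.snoc x m) w) ↔
      msp (seqS ℓ β x) w (m * seqB β x) = 0 ∧
        ∀ i, i ≤ mLen (ℓ.realize x) → i < m →
          blk (seqS ℓ β x) w i (seqB β x) = lsp (seqS ℓ β x) (D.fn (Fin.snoc x i)) (seqB β x) := by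
  simp only [collectCore, SForm.realize_and, SForm.realize_ballLen, SForm.realize_imp,
    realize_eqG (good_mspG.substArgs _) (good_num _ _),
    realize_eqG (good_blkG.substArgs _) (good_collectDigit (ℓ := ℓ) (β := β) hD),
    fn_substArgs good_mspG, fn_substArgs good_blkG, fn_num, fn_mspG, fn_blkG, Nat.cast_zero,
    fn_collectDigit hD]
  refine and_congr ?_ (forall_congr' fun i => ?_)
  · simp [Term.realize_relabel, seqS, seqB]
  · simp [Term.realize_relabel, seqS, seqB]

/-- Two named arguments after the parameters `x̄`: the variable map of `(x̄, a, b)`. [folklore] -/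
def env2 (x : Fin n → M) : Fin (n + 2) → M ⊕ Fin 2 :=
  Fin.lastCases (Sum.inr 1) (Fin.lastCases (Sum.inr 0) fun j => Sum.inl (x j))

omit [Language.boundedArith.Structure M] hB hP in
/-- The assignment of `env2`. [folklore] -/
theorem argEnv_comp_env2 (x : Fin n → M) (v : Fin 2 → M) :
    argEnv v ∘ env2 x = Fin.snoc (Fin.snoc x (v 0)) (v 1) := by
  funext j
  cases j using Fin.lastCases with
  | last => simp [env2]
  | cast j =>
    cases j using Fin.lastCases with
    | last => simp [env2]
    | cast j => simp [env2]

omit hB hP in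
/-- A `Σᵇ₁` `SForm` on `(x̄, a, b)` at parameters `x̄` defines a binary `Σᵇ₁`-definable predicate.
[cite: Buss1986, §2.1] -/
theorem _root_.Literature.Computability.MetaComplexity.SForm.isSigmabDef_snoc₂ {φ : SForm (n + 2)}
    (h : φ.IsSig) (x : Fin n → M) :
    IsSigmabDef 1 fun v : Fin 2 → M => φ.Realize (Fin.snoc (Fin.snoc x (v 0)) (v 1)) :=
  (SForm.isSigmabDef h (env2 x)).of_iff fun v => by rw [argEnv_comp_env2]

omit hB hP in
/-- Semantics of the graph of `collect`: `collectCore` at `m := |ℓ(x̄)|`. [folklore] -/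
theorem rel_collect (x : Fin n → M) (w : M) :
    (collect D ℓ β).Rel x w ↔
      (collectCore D ℓ β).Realize (Fin.snoc (Fin.snoc x (mLen (ℓ.realize x))) w) := by
  simp only [Rel, collect, SForm.realize_subst]
  refine Iff.of_eq (congrArg _ ?_)
  funext j
  cases j using Fin.lastCases with
  | last => simp
  | cast j =>
    cases j using Fin.lastCases with
    | last => simp [Term.realize_relabel, Fin.snoc_comp_castSucc]
    | cast j => simp

/-- **Semantics of `collect`** in a model of `BASIC + Σᵇ₁-PIND`: `w < 2^{|ℓ|·B}` and the blocks of
`w` below `|ℓ(x̄)|` are the (truncated) digits `D(x̄, i) mod 2ᴮ`. [cite: Buss1986, §2.5] -/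
theorem rel_collect_iff (hD : D.Good) (x : Fin n → M) (w : M) :
    (collect D ℓ β).Rel x w ↔
      msp (seqS ℓ β x) w (mLen (ℓ.realize x) * seqB β x) = 0 ∧
        ∀ i, i < mLen (ℓ.realize x) →
          blk (seqS ℓ β x) w i (seqB β x) = lsp (seqS ℓ β x) (D.fn (Fin.snoc x i)) (seqB β x) := by
  rw [rel_collect, realize_collectCore hD]
  exact and_congr Iff.rfl ⟨fun h i hi => h i hi.le hi, fun h i _ hi => h i hi⟩

/-- The induction predicate of the existence proof ("a prefix of `m` digits is coded") is `Σᵇ₁`: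
it is `∃ w ≤ 1#S, collectCore(x̄, m, w)`. [folklore] -/
private theorem isSigmabDef_collect_prefix (hD : D.Good) (x : Fin n → M) :
    IsSigmabDef 1 fun v : Fin 1 → M => ∃ w, w ≤ mSmash 1 (seqS ℓ β x) ∧
      (msp (seqS ℓ β x) w (v 0 * seqB β x) = 0 ∧
        ∀ i, i ≤ mLen (ℓ.realize x) → i < v 0 →
          blk (seqS ℓ β x) w i (seqB β x) = lsp (seqS ℓ β x) (D.fn (Fin.snoc x i)) (seqB β x)) := by
  refine ((SForm.isSigmabDef_snoc₂ (isSig_collectCore (ℓ := ℓ) (β := β) hD.sig) x).bexLE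
    (IsTermFn.const (mSmash 1 (seqS ℓ β x)))).of_iff fun v => ?_
  simp only [snoc_fin_one_zero, snoc_fin_one_one, mLe_iff, realize_collectCore hD]

/-- **`collect` is good**: existence by `Σᵇ₁`-induction on the number `m ≤ |ℓ|` of coded digits,
appending one block on top at each step; uniqueness by extensionality of block codes
(Buss 1986, §2.5; Krajíček 1995, Lemma 5.2.12). [cite: Krajicek1995, Lemma 5.2.12 (p. 69)] -/
theorem good_collect (hD : D.Good) : (collect D ℓ β).Good where
  sig := by
    have := isSig_collectCore (ℓ := ℓ) (β := β) hD.sig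
    simp_all [SForm.IsSig, collect]
  isFn M _ _ _ := by
    refine ⟨fun x => ?_, fun x w w' hw hw' => ?_, fun x w hw => ?_⟩
    · -- existence
      set L := mLen (ℓ.realize x) with hL
      set S := seqS ℓ β x with hS
      set B := seqB β x with hB'
      have hSval : S = mSmash (2 * ℓ.realize x + 1) (β.realize x) := seqS_eq x
      have key : ∀ m, m ≤ L → ∃ w, w ≤ mSmash 1 S ∧ (msp S w (m * B) = 0 ∧
          ∀ i, i ≤ L → i < m → blk S w i B = lsp S (D.fn (Fin.snoc x i)) B) := by
        intro m hm
        refine indLen (A := fun m => ∃ w, w ≤ mSmash 1 S ∧ (msp S w (m * B) = 0 ∧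
          ∀ i, i ≤ L → i < m → blk S w i B = lsp S (D.fn (Fin.snoc x i)) B))
          (isSigmabDef_collect_prefix hD x) (ℓ.realize x) ?_ ?_ hm
        · refine ⟨0, bot_le, by rw [zero_mul, msp_zero_mid], fun i _ hi => ?_⟩
          exact absurd hi (not_lt_of_ge bot_le)
        · rintro m hmL ⟨w, -, hw, hblk⟩
          set v := lsp S (D.fn (Fin.snoc x m)) B with hv'
          have hv : v < pw S B := lsp_lt_pw _ _ _
          have hmB : (m + 1) * B ≤ mLen S := by
            rw [hSval]; exact succ_mul_le_mLen_size hmL.le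
          have hmB' : m * B ≤ mLen S := by
            rw [hSval]; exact mul_le_mLen_size (hmL.le.trans (le_add_right'' _ _))
          have happ := msp_append_eq_zero' hw hv hmB
          refine ⟨v * pw S (m * B) + w, ?_, happ, fun i hiL him => ?_⟩
          · exact (msp_eq_zero_iff.1 happ).le.trans (pw_le _ _)
          · rcases ((lt_add_one_iff' i m).1 him).eq_or_lt with rfl | hlt
            · rw [blk_append_last hw, lsp_eq_self_of_lt hv]
            · obtain ⟨e, -, he⟩ := exists_add_eq_of_le_mLen hmL.le hlt.le
              have he0 : e ≠ 0 := by
                rintro rfl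
                rw [add_zero] at he
                exact hlt.ne he
              rw [blk_append_of_lt he he0 hmB', hblk i hiL hlt]
      obtain ⟨w, -, hw, hblk⟩ := key L le_rfl
      exact ⟨w, (rel_collect_iff hD x w).2 ⟨hw, fun i hi => hblk i hi.le hi⟩⟩
    · -- uniqueness
      obtain ⟨h1, h2⟩ := (rel_collect_iff hD x w).1 hw
      obtain ⟨h1', h2'⟩ := (rel_collect_iff hD x w').1 hw'
      by_cases hB0 : seqB β x = 0
      · rw [hB0, mul_zero] at h1 h1'
        rw [eq_zero_of_msp_zero h1, eq_zero_of_msp_zero h1']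
      · have hB1 : 1 ≤ seqB β x := (one_le_iff_ne_zero' _).2 hB0
        have hL : mLen (ℓ.realize x) ≤ mLen (seqS ℓ β x) := by
          rw [seqS_eq]
          exact (le_add_right'' _ _).trans (mLen_succ_le_mLen_size _ _ hB1)
        have hLB : mLen (ℓ.realize x) * seqB β x ≤ mLen (seqS ℓ β x) := by
          rw [seqS_eq]; exact mul_le_mLen_size (le_add_right'' _ _)
        exact eq_of_blk_eq hL hLB h1 h1' fun j hj => by rw [h2 j hj, h2' j hj]
    · -- bound
      obtain ⟨h1, -⟩ := (rel_collect_iff hD x w).1 hw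
      have : w ≤ mSmash 1 (seqS ℓ β x) := (msp_eq_zero_iff.1 h1).le.trans (pw_le _ _)
      simpa [collect, seqS] using (mLe_iff _ _).2 this

/-- **The blocks of `collect`** are the truncated digits: `blk(collect(x̄), i) = D(x̄, i) mod 2ᴮ` for
`i < |ℓ(x̄)|`. [cite: Buss1986, §2.5] -/
theorem blk_collect (hD : D.Good) (x : Fin n → M) {i : M} (hi : i < mLen (ℓ.realize x)) :
    blk (seqS ℓ β x) ((collect D ℓ β).fn x) i (seqB β x) =
      lsp (seqS ℓ β x) (D.fn (Fin.snoc x i)) (seqB β x) :=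
  ((rel_collect_iff hD x _).1 ((good_collect hD).isFnIn.rel_fn x)).2 i hi

/-- The blocks of `collect` are the digits themselves when these are `< 2ᴮ`. [cite: Buss1986, §2.5] -/
theorem blk_collect_of_lt (hD : D.Good) (x : Fin n → M) {i : M} (hi : i < mLen (ℓ.realize x))
    (hlt : D.fn (Fin.snoc x i) < pw (seqS ℓ β x) (seqB β x)) :
    blk (seqS ℓ β x) ((collect D ℓ β).fn x) i (seqB β x) = D.fn (Fin.snoc x i) := by
  rw [blk_collect hD x hi, lsp_eq_self_of_lt hlt]

/-- `collect(x̄) < 2^{|ℓ|·B}`. [cite: Buss1986, §2.5] -/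
theorem msp_collect (hD : D.Good) (x : Fin n → M) :
    msp (seqS ℓ β x) ((collect D ℓ β).fn x) (mLen (ℓ.realize x) * seqB β x) = 0 :=
  ((rel_collect_iff hD x _).1 ((good_collect hD).isFnIn.rel_fn x)).1

end Collect

/-! ## Bounded iteration with history (`hist`) -/

section Hist

variable (I : GDef n) (G : GDef (n + 2)) (ℓ β : Language.boundedArith.Term (Fin n))

/-- The step `u ↦ lsp(S, G(x̄, j, blk(S, w, j, B)), B)` on the context `(x̄, m, w, j)`. [folklore] -/
def histStep : GDef (n + 3) :=
  let S3 := (sizeT ℓ β).relabel (Fin.castAdd 3)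
  let B3 := Term.len (β.relabel (Fin.castAdd 3))
  let S4 := (sizeT ℓ β).relabel (Fin.castAdd 4)
  let B4 := Term.len (β.relabel (Fin.castAdd 4))
  substLast (substArgs ![S4, vU4 n, B4] lspG)
    (substLast
      (substArgs (Fin.snoc (Fin.snoc (fun i => Term.var (Fin.castAdd 4 i)) (vJ4 n)) (vU4 n)) G)
      (substArgs ![S3, vW3 n, vJ3 n, B3] blkG))

/-- The initial block `lsp(S, I(x̄), B)` on the context `(x̄, m, w)`. [folklore] -/
def histInit : GDef (n + 2) :=
  let S3 := (sizeT ℓ β).relabel (Fin.castAdd 3)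
  let B3 := Term.len (β.relabel (Fin.castAdd 3))
  substLast (substArgs ![S3, Term.var (Fin.last (n + 2)), B3] lspG)
    (substArgs (fun i => Term.var (Fin.castAdd 2 i)) I)

/-- The core formula of `hist` on the context `(x̄, m, w)`: "`w < 2^{(m+1)·B}`, `blk(w, 0) = I(x̄) mod 2ᴮ`
and `blk(w, j+1) = G(x̄, j, blk(w, j)) mod 2ᴮ` for all `j < m`" (`j` ranging over `[0, |ℓ|]`;
`B = |β|`, `S = sizeT ℓ β`) (Buss 1986, §2.6, limited iteration; Krajíček 1995, Lemma 6.1.1).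
[cite: Krajicek1995, Lemma 6.1.1 (p. 86)] -/
def histCore : SForm (n + 2) :=
  let S2 := (sizeT ℓ β).relabel (Fin.castAdd 2)
  let B2 := Term.len (β.relabel (Fin.castAdd 2))
  let S3 := (sizeT ℓ β).relabel (Fin.castAdd 3)
  let B3 := Term.len (β.relabel (Fin.castAdd 3))
  SForm.and
    (eqG (substArgs ![S2, vW2 n, Term.succ (vM2 n) * B2] mspG) (num (n + 2) 0))
    (SForm.and
      (eqG (substArgs ![S2, vW2 n, 0, B2] blkG) (histInit I ℓ β))
      (SForm.ballLen (ℓ.relabel (Fin.castAdd 2))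
        (SForm.imp (SForm.lt (vJ3 n) (vM3 n))
          (eqG (substArgs ![S3, vW3 n, Term.succ (vJ3 n), B3] blkG) (histStep G ℓ β)))))

/-- **`hist I G ℓ β`** — the history of the bounded iteration `u₀ = I(x̄) mod 2ᴮ`,
`u_{j+1} = G(x̄, j, u_j) mod 2ᴮ` for `j < |ℓ(x̄)|` (`B = |β(x̄)|`): the code `w < 2^{(|ℓ|+1)·B}` with
`blk(w, j) = u_j`; graph `histCore` at `m := |ℓ|`, bound `1 # S` (Buss 1986, §2.6: limited
iteration; Krajíček 1995, Lemma 6.1.1). [cite: Krajicek1995, Lemma 6.1.1 (p. 86)] -/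
def hist : GDef n where
  graph := (histCore I G ℓ β).subst
    (Fin.snoc (Fin.snoc (fun j => Term.var j.castSucc) (Term.len (ℓ.relabel Fin.castSucc)))
      (Term.var (Fin.last n)))
  bound := Term.smash (natConst 1) (sizeT ℓ β)

/-- **`iterate I G ℓ β`** — the final value `u_{|ℓ|}` of the bounded iteration: the block `|ℓ|`
of `hist` (Buss 1986, §2.6). [cite: Krajicek1995, Lemma 6.1.1 (p. 86)] -/
def iterate : GDef n :=
  substLast
    (substArgs ![(sizeT ℓ β).relabel (Fin.castAdd 1), Term.var (Fin.last n),
      Term.len (ℓ.relabel (Fin.castAdd 1)), Term.len (β.relabel (Fin.castAdd 1))] blkG)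
    (hist I G ℓ β)

open BASICModel

variable {I G ℓ β}
variable {M : Type} [Language.boundedArith.Structure M] [hB : M ⊨ BASIC]
  [hP : M ⊨ PINDScheme (sigmabFormulas 1)]

omit [Language.boundedArith.Structure M] hB hP in
/-- `histStep` is good for good `G`. [folklore] -/
theorem good_histStep (hG : G.Good) : (histStep G ℓ β).Good :=
  (good_lspG.substArgs _).substLast ((hG.substArgs _).substLast (good_blkG.substArgs _))

omit [Language.boundedArith.Structure M] hB hP in
/-- `histInit` is good for good `I`. [folklore] -/
theorem good_histInit (hI : I.Good) : (histInit I ℓ β).Good :=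
  (good_lspG.substArgs _).substLast (hI.substArgs _)

omit [Language.boundedArith.Structure M] hB hP in
/-- `histCore` is `Σᵇ₁` for good `I`, `G`. [folklore] -/
theorem isSig_histCore (hI : I.graph.IsSig) (hG : G.graph.IsSig) : (histCore I G ℓ β).IsSig := by
  have h1 : mspG.graph.cls.2.1 = true := good_mspG.sig
  have h2 : blkG.graph.cls.2.1 = true := good_blkG.sig
  have h3 : lspG.graph.cls.2.1 = true := good_lspG.sig
  simp_all [SForm.IsSig, histCore, histInit, histStep, SForm.cls, eqG, GDef.substArgs,
    GDef.substLast, num, ofTerm, SForm.lt]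

omit hB hP in
/-- The arguments `(x̄, j, u)` of `G` read off the context `(x̄, m, w, j, u)`. [folklore] -/
theorem realize_argsG (x : Fin n → M) (m w j u : M) :
    (fun i => Term.realize (Fin.snoc (Fin.snoc (Fin.snoc (Fin.snoc x m) w) j) u : Fin (n + 4) → M)
      (Fin.snoc (α := fun _ => Language.boundedArith.Term (Fin (n + 4)))
        (Fin.snoc (α := fun _ => Language.boundedArith.Term (Fin (n + 4)))
          (fun i => Term.var (Fin.castAdd 4 i)) (vJ4 n)) (vU4 n) i)) =
      Fin.snoc (Fin.snoc x j) u := by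
  funext i
  cases i using Fin.lastCases with
  | last => simp
  | cast i =>
    cases i using Fin.lastCases with
    | last => simp
    | cast i => simp [castAdd_four_eq]

omit hB hP in
/-- The arguments `x̄` of `I` read off the context `(x̄, m, w)`. [folklore] -/
theorem realize_argsI (x : Fin n → M) (m w : M) :
    (fun i => Term.realize (Fin.snoc (Fin.snoc x m) w : Fin (n + 2) → M)
      (Term.var (Fin.castAdd 2 i) : Language.boundedArith.Term (Fin (n + 2)))) = x := by
  funext i
  simp [castAdd_two_eq]

/-- The value of `histStep`: `lsp(S, G(x̄, j, blk(S, w, j, B)), B)`. [folklore] -/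
theorem fn_histStep (hG : G.Good) (x : Fin n → M) (m w j : M) :
    (histStep G ℓ β).fn (Fin.snoc (Fin.snoc (Fin.snoc x m) w) j) =
      lsp ((sizeT ℓ β).realize x)
        (G.fn (Fin.snoc (Fin.snoc x j)
          (blk ((sizeT ℓ β).realize x) w j (mLen (β.realize x))))) (mLen (β.realize x)) := by
  rw [histStep, fn_substLast (good_lspG.substArgs _) ((hG.substArgs _).substLast (good_blkG.substArgs _)),
    fn_substArgs good_lspG, fn_substLast (hG.substArgs _) (good_blkG.substArgs _),
    fn_substArgs hG, fn_substArgs good_blkG, fn_lspG, fn_blkG, realize_argsG]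
  simp [Term.realize_relabel]

/-- The value of `histInit`: `lsp(S, I(x̄), B)`. [folklore] -/
theorem fn_histInit (hI : I.Good) (x : Fin n → M) (m w : M) :
    (histInit I ℓ β).fn (Fin.snoc (Fin.snoc x m) w) =
      lsp ((sizeT ℓ β).realize x) (I.fn x) (mLen (β.realize x)) := by
  rw [histInit, fn_substLast (good_lspG.substArgs _) (hI.substArgs _), fn_substArgs good_lspG,
    fn_substArgs hI, fn_lspG, realize_argsI]
  simp [Term.realize_relabel]

/-- **Semantics of `histCore`**. [cite: Krajicek1995, Lemma 6.1.1 (p. 86)] -/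
theorem realize_histCore (hI : I.Good) (hG : G.Good) (x : Fin n → M) (m w : M) :
    (histCore I G ℓ β).Realize (Fin.snoc (Fin.snoc x m) w) ↔
      msp ((sizeT ℓ β).realize x) w ((m + 1) * mLen (β.realize x)) = 0 ∧
        blk ((sizeT ℓ β).realize x) w 0 (mLen (β.realize x)) =
            lsp ((sizeT ℓ β).realize x) (I.fn x) (mLen (β.realize x)) ∧
          ∀ j, j ≤ mLen (ℓ.realize x) → j < m →
            blk ((sizeT ℓ β).realize x) w (j + 1) (mLen (β.realize x)) =
              lsp ((sizeT ℓ β).realize x)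
                (G.fn (Fin.snoc (Fin.snoc x j) (blk ((sizeT ℓ β).realize x) w j (mLen (β.realize x)))))
                (mLen (β.realize x)) := by
  simp only [histCore, SForm.realize_and, SForm.realize_ballLen, SForm.realize_imp,
    realize_eqG (good_mspG.substArgs _) (good_num _ _),
    realize_eqG (good_blkG.substArgs _) (good_histInit (ℓ := ℓ) (β := β) hI),
    realize_eqG (good_blkG.substArgs _) (good_histStep (ℓ := ℓ) (β := β) hG),
    fn_substArgs good_mspG, fn_substArgs good_blkG, fn_num, fn_mspG, fn_blkG, Nat.cast_zero,
    fn_histInit hI, fn_histStep hG]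
  refine and_congr ?_ (and_congr ?_ (forall_congr' fun j => ?_))
  · simp [Term.realize_relabel]
  · simp [Term.realize_relabel]
  · simp [Term.realize_relabel]

omit hB hP in
/-- Semantics of the graph of `hist`: `histCore` at `m := |ℓ(x̄)|`. [folklore] -/
theorem rel_hist (x : Fin n → M) (w : M) :
    (hist I G ℓ β).Rel x w ↔ (histCore I G ℓ β).Realize (Fin.snoc (Fin.snoc x (mLen (ℓ.realize x))) w) := by
  simp only [Rel, hist, SForm.realize_subst]
  refine Iff.of_eq (congrArg _ ?_)
  funext j
  cases j using Fin.lastCases with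
  | last => simp
  | cast j =>
    cases j using Fin.lastCases with
    | last => simp [Term.realize_relabel, Fin.snoc_comp_castSucc]
    | cast j => simp

/-- **Semantics of `hist`** in a model of `BASIC + Σᵇ₁-PIND`. [cite: Krajicek1995, Lemma 6.1.1 (p. 86)] -/
theorem rel_hist_iff (hI : I.Good) (hG : G.Good) (x : Fin n → M) (w : M) :
    (hist I G ℓ β).Rel x w ↔
      msp (seqS ℓ β x) w ((mLen (ℓ.realize x) + 1) * seqB β x) = 0 ∧
        blk (seqS ℓ β x) w 0 (seqB β x) = lsp (seqS ℓ β x) (I.fn x) (seqB β x) ∧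
          ∀ j, j < mLen (ℓ.realize x) →
            blk (seqS ℓ β x) w (j + 1) (seqB β x) =
              lsp (seqS ℓ β x) (G.fn (Fin.snoc (Fin.snoc x j) (blk (seqS ℓ β x) w j (seqB β x))))
                (seqB β x) := by
  rw [rel_hist, realize_histCore hI hG]
  simp only [seqS, seqB]
  exact and_congr Iff.rfl (and_congr Iff.rfl
    ⟨fun h j hj => h j hj.le hj, fun h j _ hj => h j hj⟩)

/-- The induction predicate of the existence proof for `hist` is `Σᵇ₁`: `∃ w ≤ 1#S, histCore(x̄, m, w)`.
[folklore] -/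
private theorem isSigmabDef_hist_prefix (hI : I.Good) (hG : G.Good) (x : Fin n → M) :
    IsSigmabDef 1 fun v : Fin 1 → M => ∃ w, w ≤ mSmash 1 (seqS ℓ β x) ∧
      (msp (seqS ℓ β x) w ((v 0 + 1) * seqB β x) = 0 ∧
        blk (seqS ℓ β x) w 0 (seqB β x) = lsp (seqS ℓ β x) (I.fn x) (seqB β x) ∧
          ∀ j, j ≤ mLen (ℓ.realize x) → j < v 0 →
            blk (seqS ℓ β x) w (j + 1) (seqB β x) =
              lsp (seqS ℓ β x) (G.fn (Fin.snoc (Fin.snoc x j) (blk (seqS ℓ β x) w j (seqB β x))))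
                (seqB β x)) := by
  refine ((SForm.isSigmabDef_snoc₂ (isSig_histCore (ℓ := ℓ) (β := β) hI.sig hG.sig) x).bexLE
    (IsTermFn.const (mSmash 1 (seqS ℓ β x)))).of_iff fun v => ?_
  simp only [snoc_fin_one_zero, snoc_fin_one_one, mLe_iff, realize_histCore hI hG]
  rfl

/-- Blocks of `hist`-like codes agree: if two codes satisfy the recursion below `L ≤ |ℓ|` and have
the same block `0`, all their blocks `≤ L` agree (`Σᵇ₁`-induction along `[0, L]`). [folklore] -/
private theorem blk_eq_of_rec (x : Fin n → M) {w w' L : M} (hL : L ≤ mLen (ℓ.realize x))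
    (h0 : blk (seqS ℓ β x) w 0 (seqB β x) = blk (seqS ℓ β x) w' 0 (seqB β x))
    (hw : ∀ j, j < L → blk (seqS ℓ β x) w (j + 1) (seqB β x) =
      lsp (seqS ℓ β x) (G.fn (Fin.snoc (Fin.snoc x j) (blk (seqS ℓ β x) w j (seqB β x)))) (seqB β x))
    (hw' : ∀ j, j < L → blk (seqS ℓ β x) w' (j + 1) (seqB β x) =
      lsp (seqS ℓ β x) (G.fn (Fin.snoc (Fin.snoc x j) (blk (seqS ℓ β x) w' j (seqB β x)))) (seqB β x))
    {j : M} (hj : j ≤ L) : blk (seqS ℓ β x) w j (seqB β x) = blk (seqS ℓ β x) w' j (seqB β x) := by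
  obtain ⟨y, -, hy⟩ := exists_mLen_eq hL
  have hjy : j ≤ mLen y := hy ▸ hj
  refine indLen (A := fun j => j ≤ L → blk (seqS ℓ β x) w j (seqB β x) = blk (seqS ℓ β x) w' j (seqB β x))
    ?_ y (fun _ => h0) ?_ hjy hj
  · refine IsSigmabDef.imp ((isQFDef_le (IsTermFn.proj 0) (IsTermFn.const L)).isPibDef 1) ?_
    exact ((isSigmabFn_blk.substAll (T := ![fun _ => seqS ℓ β x, fun _ => w, fun v => v 0, fun _ => seqB β x])
        (fun k => by fin_cases k <;> first | exact IsTermFn.const _ | exact IsTermFn.proj 0)).isDeltabDef_eq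
      (isSigmabFn_blk.substAll (T := ![fun _ => seqS ℓ β x, fun _ => w', fun v => v 0, fun _ => seqB β x])
        (fun k => by fin_cases k <;> first | exact IsTermFn.const _ | exact IsTermFn.proj 0))).1.of_iff
      fun v => by simp
  · intro k hk ih hk1
    have hkL : k < L := (add_one_le_iff' _ _).1 hk1
    rw [hw k hkL, hw' k hkL, ih hkL.le]

/-- **`hist` is good**: existence by `Σᵇ₁`-induction on the prefix length `m ≤ |ℓ|`, appending the
next block `G(x̄, m, u_m) mod 2ᴮ` on top; uniqueness blockwise by induction and then by
extensionality of block codes (Buss 1986, §2.6; Krajíček 1995, Lemma 6.1.1).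
[cite: Krajicek1995, Lemma 6.1.1 (p. 86)] -/
theorem good_hist (hI : I.Good) (hG : G.Good) : (hist I G ℓ β).Good where
  sig := by
    have := isSig_histCore (ℓ := ℓ) (β := β) hI.sig hG.sig
    simp_all [SForm.IsSig, hist]
  isFn M _ _ _ := by
    refine ⟨fun x => ?_, fun x w w' hw hw' => ?_, fun x w hw => ?_⟩
    · -- existence
      set L := mLen (ℓ.realize x) with hL
      set S := seqS ℓ β x with hS
      set B := seqB β x with hB'
      have hSval : S = mSmash (2 * ℓ.realize x + 1) (β.realize x) := seqS_eq x
      have hBS : B ≤ mLen S := seqB_le x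
      have key : ∀ m, m ≤ L → ∃ w, w ≤ mSmash 1 S ∧ (msp S w ((m + 1) * B) = 0 ∧
          blk S w 0 B = lsp S (I.fn x) B ∧
          ∀ j, j ≤ L → j < m → blk S w (j + 1) B =
            lsp S (G.fn (Fin.snoc (Fin.snoc x j) (blk S w j B))) B) := by
        intro m hm
        refine indLen (A := fun m => ∃ w, w ≤ mSmash 1 S ∧ (msp S w ((m + 1) * B) = 0 ∧
          blk S w 0 B = lsp S (I.fn x) B ∧
          ∀ j, j ≤ L → j < m → blk S w (j + 1) B =
            lsp S (G.fn (Fin.snoc (Fin.snoc x j) (blk S w j B))) B))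
          (isSigmabDef_hist_prefix hI hG x) (ℓ.realize x) ?_ ?_ hm
        · -- `m = 0`: the single block `lsp S (I x̄) B`
          have hv : lsp S (I.fn x) B < pw S B := lsp_lt_pw _ _ _
          refine ⟨lsp S (I.fn x) B, hv.le.trans (pw_le _ _), ?_, ?_, fun j _ hj => ?_⟩
          · rw [zero_add, one_mul]; exact msp_eq_zero_of_lt hv
          · rw [blk, zero_mul, msp_zero_right, lsp_lsp_of_le le_rfl]
          · exact absurd hj (not_lt_of_ge bot_le)
        · rintro m hmL ⟨w, -, hw, h0, hstep⟩
          set v := lsp S (G.fn (Fin.snoc (Fin.snoc x m) (blk S w m B))) B with hv'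
          have hv : v < pw S B := lsp_lt_pw _ _ _
          have hm1 : m + 1 ≤ L := (add_one_le_iff' _ _).2 hmL
          have hmB : (m + 1 + 1) * B ≤ mLen S := by rw [hSval]; exact succ_mul_le_mLen_size hm1
          have hmB' : (m + 1) * B ≤ mLen S := by
            rw [hSval]; exact mul_le_mLen_size (hm1.trans (le_add_right'' _ _))
          have happ := msp_append_eq_zero' hw hv hmB
          refine ⟨v * pw S ((m + 1) * B) + w, (msp_eq_zero_iff.1 happ).le.trans (pw_le _ _), happ,
            ?_, fun j hjL hjm => ?_⟩
          · rw [blk_append_of_lt (zero_add (m + 1))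
              (lt_of_le_of_lt (zero_le_model m) (lt_add_one' m)).ne' hmB', h0]
          · rcases ((lt_add_one_iff' j m).1 hjm).eq_or_lt with rfl | hlt
            · -- the new block
              rw [blk_append_last hw, lsp_eq_self_of_lt hv,
                blk_append_of_lt rfl one_ne_zero hmB']
            · -- old blocks
              obtain ⟨e, -, he⟩ := exists_add_eq_of_le_mLen hm1 (add_le_add_left hlt.le 1)
              have he0 : e ≠ 0 := by
                rintro rfl
                rw [add_zero] at he
                exact hlt.ne (add_right_cancel he)
              obtain ⟨e', -, he'⟩ := exists_add_eq_of_le_mLen hm1 (hlt.le.trans (le_add_right'' _ _))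
              have he0' : e' ≠ 0 := by
                rintro rfl
                rw [add_zero] at he'
                exact (hlt.trans (lt_add_one' m)).ne he'
              rw [blk_append_of_lt he he0 hmB', blk_append_of_lt he' he0' hmB', hstep j hjL hlt]
      obtain ⟨w, -, hw, h0, hstep⟩ := key L le_rfl
      exact ⟨w, (rel_hist_iff hI hG x w).2 ⟨hw, h0, fun j hj => hstep j hj.le hj⟩⟩
    · -- uniqueness
      obtain ⟨h1, h2, h3⟩ := (rel_hist_iff hI hG x w).1 hw
      obtain ⟨h1', h2', h3'⟩ := (rel_hist_iff hI hG x w').1 hw'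
      by_cases hB0 : seqB β x = 0
      · rw [hB0, mul_zero] at h1 h1'
        rw [eq_zero_of_msp_zero h1, eq_zero_of_msp_zero h1']
      · have hB1 : 1 ≤ seqB β x := (one_le_iff_ne_zero' _).2 hB0
        have hL : mLen (ℓ.realize x) + 1 ≤ mLen (seqS ℓ β x) := by
          rw [seqS_eq]; exact mLen_succ_le_mLen_size _ _ hB1
        have hLB : (mLen (ℓ.realize x) + 1) * seqB β x ≤ mLen (seqS ℓ β x) := by
          rw [seqS_eq]; exact mul_le_mLen_size le_rfl
        refine eq_of_blk_eq hL hLB h1 h1' fun j hj => ?_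
        exact blk_eq_of_rec x le_rfl (h2.trans h2'.symm) h3 h3' ((lt_add_one_iff' _ _).1 hj)
    · -- bound
      obtain ⟨h1, -⟩ := (rel_hist_iff hI hG x w).1 hw
      have : w ≤ mSmash 1 (seqS ℓ β x) := (msp_eq_zero_iff.1 h1).le.trans (pw_le _ _)
      simpa [hist, seqS] using (mLe_iff _ _).2 this

/-- `hist(x̄) < 2^{(|ℓ|+1)·B}`. [cite: Krajicek1995, Lemma 6.1.1 (p. 86)] -/
theorem msp_hist (hI : I.Good) (hG : G.Good) (x : Fin n → M) :
    msp (seqS ℓ β x) ((hist I G ℓ β).fn x) ((mLen (ℓ.realize x) + 1) * seqB β x) = 0 :=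
  ((rel_hist_iff hI hG x _).1 ((good_hist hI hG).isFnIn.rel_fn x)).1

/-- **Block `0` of `hist`** is `I(x̄) mod 2ᴮ`. [cite: Krajicek1995, Lemma 6.1.1 (p. 86)] -/
theorem blk_hist_zero (hI : I.Good) (hG : G.Good) (x : Fin n → M) :
    blk (seqS ℓ β x) ((hist I G ℓ β).fn x) 0 (seqB β x) = lsp (seqS ℓ β x) (I.fn x) (seqB β x) :=
  ((rel_hist_iff hI hG x _).1 ((good_hist hI hG).isFnIn.rel_fn x)).2.1

/-- **Block `j + 1` of `hist`** is `G(x̄, j, block j) mod 2ᴮ` (`j < |ℓ(x̄)|`).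
[cite: Krajicek1995, Lemma 6.1.1 (p. 86)] -/
theorem blk_hist_succ (hI : I.Good) (hG : G.Good) (x : Fin n → M) {j : M} (hj : j < mLen (ℓ.realize x)) :
    blk (seqS ℓ β x) ((hist I G ℓ β).fn x) (j + 1) (seqB β x) =
      lsp (seqS ℓ β x) (G.fn (Fin.snoc (Fin.snoc x j) (blk (seqS ℓ β x) ((hist I G ℓ β).fn x) j (seqB β x))))
        (seqB β x) :=
  ((rel_hist_iff hI hG x _).1 ((good_hist hI hG).isFnIn.rel_fn x)).2.2 j hj

omit [Language.boundedArith.Structure M] hB hP in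
/-- **`iterate` is good.** [cite: Krajicek1995, Lemma 6.1.1 (p. 86)] -/
theorem good_iterate (hI : I.Good) (hG : G.Good) : (iterate I G ℓ β).Good :=
  (good_blkG.substArgs _).substLast (good_hist hI hG)

/-- **The value of `iterate`** is the last block of `hist`: `u_{|ℓ(x̄)|}`.
[cite: Krajicek1995, Lemma 6.1.1 (p. 86)] -/
theorem fn_iterate (hI : I.Good) (hG : G.Good) (x : Fin n → M) :
    (iterate I G ℓ β).fn x = blk (seqS ℓ β x) ((hist I G ℓ β).fn x) (mLen (ℓ.realize x)) (seqB β x) := by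
  rw [iterate, fn_substLast (good_blkG.substArgs _) (good_hist hI hG), fn_substArgs good_blkG, fn_blkG]
  simp [Term.realize_relabel, seqS, seqB]

end Hist

end GDef

end Literature.Computability.MetaComplexity
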